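import Literature.Analysis.FluidPDE.RusinSverakSingularityStabilityEpsilon
import Literature.Analysis.FluidPDE.CKNEpsilonRegularityHolds
import HarnessLib.Audit
import HarnessLib

/-!
# L3TimeExponentPincer — uniform bounds near a regular point of the limit (quantitative stability of regularity)

Support kernel for the crux `L3CascadeJaw` (item stmt-NavierStokesRegularity-19499) of route
`L3TimeExponentPincer`, for the compactness step (J) of planner nsreg-p2's ROUND-12 §2b
(`CritSmoothingNoSwirlB ⇐ (SFL³)`): there the approximants `u^k` are SMOOTH with
`|u^k(0, 1)| → ∞`, so Rusin–Šverák's Lemma 2.1 in its printed (qualitative) form — singular points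
of the `u^k` accumulate only at singular points of the limit (tree: the named fact
`rusin_sverak_stability_of_singularities`, discharged) — does not apply; what is needed is the
QUANTITATIVE content of its proof: near a regular point of the limit the approximants are
UNIFORMLY bounded for large `k`.  This file extracts exactly that from the tree's proof:

* `oneScale_bound_of_theorem15_3` — the one-scale ε-regularity criterion with its bound:
  from the PROVED Thm. 15.3 of Robinson–Rodrigo–Sadowski (`RRS2016.theorem15_3_holds`:
  `‖u‖_{L^∞(Q_{1/2})} ≤ c_M ε₀^{1/3}` at unit scale) by the Navier–Stokes scaling, for a suitable weak
  solution on `O ⊇ Q̄_r(z)`: `C(r; z) + D(r; z) ≤ ε₀ ⟹ |u| ≤ C/r` a.e. on `Q_{r/2}(z)`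
  (`C = c_M ε₀^{1/3}`; the accepted `RRS2016.theorem15_3.unforced_oneScale` records only
  `u ∈ L^∞(Q_{r/2}(z))` — its proof, repeated here, ends with this bound).
* `uniform_bound_near_regularPoint_of_unforced`, `uniform_bound_near_regularPoint` — **in the
  situation of Rusin–Šverák's Prop. 2.2 (`RusinSverak2011.CompactnessSituation O u^k p^k u p`), if
  `z₀ ∈ O` is a regular point of the limit `u`, then there are `ρ > 0` and `B` with
  `|u^k| ≤ B` a.e. on the centred cylinder `Q*_ρ(z₀)` for all large `k`.**  Proof = the tree's
  proof of Lemma 2.1 (`rusin_sverak_stability_of_singularities_of_unforced`: the printed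
  `u`-argument, the pressure decay estimate iterated along the scales `θʲ r₀` at the shifted centre
  `(t₀ + s²/8, x₀)`, then the one-scale criterion at the last scale `s`), with the qualitative
  criterion replaced by `oneScale_bound_of_theorem15_3`: the radius `s`, the shift and hence the
  bound `B = C/s` do not depend on `k`.
* `not_isRegularPoint_of_unbounded` — contrapositive in the form used by (J): if continuous
  approximants satisfy `‖u^k(z_k)‖ → ∞` along `z_k → z₀`, then `z₀` is a singular point of the
  limit.

Sources: W. Rusin, V. Šverák, J. Funct. Anal. 260 (2011) = arXiv:0911.0500, Lemma 2.1 and its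
proof (p. 4); Caffarelli–Kohn–Nirenberg 1982, Proposition 1 and Corollary (`|u| ≤ C₁ r⁻¹` on
`Q_{r/2}`); Robinson–Rodrigo–Sadowski 2016, Thm. 15.3–15.4, Cor. 15.6.
WHAT THIS IS NOT: not NS regularity or blow-up; ε-regularity bookkeeping over proved tree
theorems; the crux `L3CascadeJaw` is untouched; no crux claim.
-/

noncomputable section

open MeasureTheory Set Function Filter Topology TopologicalSpace Metric
open scoped NNReal ENNReal InnerProductSpace RealInnerProductSpace

namespace Summit.NavierStokesRegularity.NavierStokesRegularity.Theorems.L3TimeExponentPincerRegularPointUniformBound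

open Literature.Analysis.FluidPDE

/-! ### The one-scale criterion with its bound -/

/-- **One-scale ε-regularity with the bound `C/r`** (Caffarelli–Kohn–Nirenberg 1982, Prop. 1 and
Corollary; Robinson–Rodrigo–Sadowski 2016, Thm. 15.4 from Thm. 15.3 by scaling): there are absolute
`ε₀ > 0`, `C > 0` such that for a suitable weak solution `(u, p)` (`ν = 1`, no force) on an open
`O` and a cylinder with `Q̄_r(z) ⊆ O`, `C(r; z) + D(r; z) ≤ ε₀` implies `|u| ≤ C/r` a.e. on
`Q_{r/2}(z)`.  Proof identical to the tree's `RRS2016.theorem15_3.unforced_oneScale` (restrict to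
`Q_r(z)`, rescale onto `Q_1(0,0)`, apply Thm. 15.3 to the suitable pair, pull back), keeping the
bound `c_M ε₀^{1/3}/r` that proof ends with. -/
theorem oneScale_bound_of_theorem15_3 (h : RRS2016.theorem15_3) :
    ∃ ε₀ C : ℝ, 0 < ε₀ ∧ 0 < C ∧ ∀ (O : Opens (ℝ × (EuclideanSpace ℝ (Fin 3))))
      (u : ℝ → (EuclideanSpace ℝ (Fin 3)) → (EuclideanSpace ℝ (Fin 3)))
      (p : ℝ → (EuclideanSpace ℝ (Fin 3)) → ℝ),
      IsSuitableWeakSolutionOn O 1 0 u p → ∀ (z : ℝ × (EuclideanSpace ℝ (Fin 3))) (r : ℝ), 0 < r →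
        closure (parabolicCylinder r z) ⊆ (O : Set (ℝ × (EuclideanSpace ℝ (Fin 3)))) →
        cknC r z u + cknD r z p ≤ ENNReal.ofReal ε₀ →
        ∀ᵐ w ∂(volume.restrict (parabolicCylinder (r / 2) z)), ‖u w.1 w.2‖ ≤ C / r := by
  obtain ⟨ε₁, cM, hε₁, hcM, H⟩ := h
  refine ⟨ε₁, cM * ε₁ ^ (1 / 3 : ℝ), hε₁, by positivity, fun O u p hsws z r hr hcl hsmall => ?_⟩
  obtain ⟨G, hS⟩ := hsws.isLRSuitableWeakSolutionOn_parabolicCylinder hr hcl 3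
  have hβ0 : (0 : ℝ) < r ^ 2 := by positivity
  -- the rescaled datum on `Φ⁻¹(Q_r(z)) = Q_1(0, 0)`
  have hS' := hS.nsRescale hr z.1 z.2
  have hf0 : ((r ^ 2 * r) • stPull (r ^ 2) r z.1 z.2
      (0 : ℝ → EuclideanSpace ℝ (Fin 3) → EuclideanSpace ℝ (Fin 3))) = 0 := by
    funext s y
    rw [smul_stPull_apply, Pi.zero_apply, Pi.zero_apply, smul_zero, Pi.zero_apply, Pi.zero_apply]
  rw [hf0] at hS'
  set Φ := stAffine (r ^ 2) r z.1 z.2 with hΦ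
  have hpre : ∀ ρ : ℝ, Φ ⁻¹' parabolicCylinder ρ z =
      parabolicCylinder (ρ / r) (0 : ℝ × EuclideanSpace ℝ (Fin 3)) :=
    fun ρ => stAffine_sq_preimage_parabolicCylinder hr z ρ
  have hpre1 : Φ ⁻¹' parabolicCylinder r z = parabolicCylinder 1 (0 : ℝ × EuclideanSpace ℝ (Fin 3)) := by
    rw [hpre, div_self hr.ne']
  have hpre2 : Φ ⁻¹' parabolicCylinder (r / 2) z =
      parabolicCylinder (1 / 2) (0 : ℝ × EuclideanSpace ℝ (Fin 3)) := by
    rw [hpre]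
    congr 1
    field_simp
  have h1 : parabolicCylinder 1 (0 : ℝ × EuclideanSpace ℝ (Fin 3)) ⊆
      ((stPreimage (r ^ 2) r z.1 z.2 (parabolicCylinderOpens r z) :
        Opens (ℝ × EuclideanSpace ℝ (Fin 3))) : Set (ℝ × EuclideanSpace ℝ (Fin 3))) := by
    rw [coe_stPreimage, coe_parabolicCylinderOpens, ← hΦ, hpre1]
  -- the suitable pair on the unit cylinder
  have hP := hS'.isSuitablePair (by norm_num : (1 : ℝ) ≤ 3) (fun φ _ => by simp) h1
  -- the smallness hypothesis (15.18) of the rescaled pair is `C(r; z) + D(r; z) ≤ ε₁`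
  have hpm : AEMeasurable (fun w : ℝ × EuclideanSpace ℝ (Fin 3) => ‖p w.1 w.2‖ₑ ^ (3 / 2 : ℝ))
      (volume.restrict (parabolicCylinder r z)) :=
    (hS.distributional.2.2.1.aestronglyMeasurable).aemeasurable.enorm.pow_const _
  have h0 : ENNReal.ofReal r ^ 2 ≠ 0 := pow_ne_zero _ (ENNReal.ofReal_pos.2 hr).ne'
  have ht : ENNReal.ofReal r ^ 2 ≠ ⊤ := ENNReal.pow_ne_top ENNReal.ofReal_ne_top
  have hJ : ENNReal.ofReal (r ^ 2 * r ^ Module.finrank ℝ (EuclideanSpace ℝ (Fin 3)))⁻¹ =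
      ENNReal.ofReal (r ^ 5)⁻¹ := by
    rw [finrank_euclideanSpace_three]
    congr 1
    ring
  have hsmall' : RRS2016.Small ε₁ (r • stPull (r ^ 2) r z.1 z.2 u) (r ^ 2 • stPull (r ^ 2) r z.1 z.2 p)
      (0 : ℝ × EuclideanSpace ℝ (Fin 3)) := by
    set Fs : ℝ × EuclideanSpace ℝ (Fin 3) → ℝ≥0∞ := fun w =>
      ‖u w.1 w.2‖ₑ ^ (3 : ℕ) + ‖p w.1 w.2‖ₑ ^ (3 / 2 : ℝ) with hFs
    have hpt : ∀ w : ℝ × EuclideanSpace ℝ (Fin 3),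
        ‖(r • stPull (r ^ 2) r z.1 z.2 u) w.1 w.2‖ₑ ^ (3 : ℕ) +
          ‖(r ^ 2 • stPull (r ^ 2) r z.1 z.2 p) w.1 w.2‖ₑ ^ (3 / 2 : ℝ) =
        ENNReal.ofReal (r ^ 3) * Fs (Φ w) := by
      intro w
      rw [smul_stPull_apply, smul_stPull_apply, enorm_smul, enorm_smul, mul_pow,
        ENNReal.mul_rpow_of_nonneg _ _ (by norm_num), Real.enorm_eq_ofReal hr.le,
        Real.enorm_eq_ofReal hβ0.le, ← ENNReal.ofReal_pow hr.le,
        ENNReal.ofReal_rpow_of_nonneg hβ0.le (by norm_num), sq_rpow_threeHalves hr.le,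
        hFs, mul_add]
      rfl
    have hFint : ∫⁻ w in parabolicCylinder r z, Fs w =
        ENNReal.ofReal r ^ 2 * (cknC r z u + cknD r z p) := by
      rw [hFs, lintegral_add_right' _ hpm, mul_add, cknC, cknD, ← mul_assoc, ← mul_assoc,
        ENNReal.mul_inv_cancel h0 ht, one_mul, one_mul]
    unfold RRS2016.Small
    simp_rw [hpt]
    rw [lintegral_const_mul' _ _ ENNReal.ofReal_ne_top, ← hpre1,
      setLIntegral_preimage_comp_stAffine hβ0 hr z.1 z.2 Fs, hJ, hFint]
    calc ENNReal.ofReal (r ^ 3) * (ENNReal.ofReal (r ^ 5)⁻¹ *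
          (ENNReal.ofReal r ^ 2 * (cknC r z u + cknD r z p)))
        ≤ ENNReal.ofReal (r ^ 3) * (ENNReal.ofReal (r ^ 5)⁻¹ *
          (ENNReal.ofReal r ^ 2 * ENNReal.ofReal ε₁)) := by gcongr
      _ = ENNReal.ofReal ε₁ := by
          rw [← ENNReal.ofReal_pow hr.le, ← ENNReal.ofReal_mul (by positivity),
            ← ENNReal.ofReal_mul (by positivity), ← ENNReal.ofReal_mul (by positivity)]
          congr 1
          field_simp
  -- Thm. 15.3 for the rescaled pair, transported back along `Φ`
  have key := H 0 _ _ _ hP ε₁ hε₁ le_rfl hsmall'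
  rw [← hpre2] at key
  have key' := ae_restrict_of_ae_restrict_preimage_stAffine hβ0 hr z.1 z.2
    (S := parabolicCylinder (r / 2) z) (P := fun w => ‖r • u w.1 w.2‖ ≤ cM * ε₁ ^ (1 / 3 : ℝ)) key
  filter_upwards [key'] with w hw
  rw [norm_smul, Real.norm_eq_abs, abs_of_pos hr] at hw
  show ‖u w.1 w.2‖ ≤ cM * ε₁ ^ (1 / 3 : ℝ) / r
  rw [le_div_iff₀ hr, mul_comm]
  exact hw


/-! ### Uniform bounds near a regular point of the limit -/

/-- **Quantitative stability of regularity** (the content of the proof of Rusin–Šverák 2011,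
Lemma 2.1 = Jia–Šverák 2013, Lemma 6): in the situation of Prop. 2.2 on `O`, if `z₀ ∈ O` is a
regular point of the limit `u` (essentially bounded on some centred cylinder `Q*_{ρ₀}(z₀)`), then
for some `ρ > 0` and `B`, `|u^k| ≤ B` a.e. on `Q*_ρ(z₀)` for all sufficiently large `k`.  Version
over the pressure decay estimate and a quantitative unforced one-scale criterion (both supplied
below by proved tree theorems). -/
theorem uniform_bound_near_regularPoint_of_unforced
    (hPD : seregin_sverak_pressure_decay)
    (hU : ∃ ε₀ C : ℝ, 0 < ε₀ ∧ 0 < C ∧ ∀ (O : Opens (ℝ × (EuclideanSpace ℝ (Fin 3))))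
      (u : ℝ → (EuclideanSpace ℝ (Fin 3)) → (EuclideanSpace ℝ (Fin 3))) (p : ℝ → (EuclideanSpace ℝ (Fin 3)) → ℝ),
      IsSuitableWeakSolutionOn O 1 0 u p → ∀ (z : ℝ × (EuclideanSpace ℝ (Fin 3))) (r : ℝ), 0 < r →
        closure (parabolicCylinder r z) ⊆ (O : Set (ℝ × (EuclideanSpace ℝ (Fin 3)))) →
        cknC r z u + cknD r z p ≤ ENNReal.ofReal ε₀ →
        ∀ᵐ w ∂(volume.restrict (parabolicCylinder (r / 2) z)), ‖u w.1 w.2‖ ≤ C / r)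
    {O : Opens (ℝ × (EuclideanSpace ℝ (Fin 3)))}
    {useq : ℕ → ℝ → (EuclideanSpace ℝ (Fin 3)) → (EuclideanSpace ℝ (Fin 3))}
    {pseq : ℕ → ℝ → (EuclideanSpace ℝ (Fin 3)) → ℝ}
    {u : ℝ → (EuclideanSpace ℝ (Fin 3)) → (EuclideanSpace ℝ (Fin 3))} {p : ℝ → (EuclideanSpace ℝ (Fin 3)) → ℝ}
    (hsit : RusinSverak2011.CompactnessSituation O useq pseq u p)
    {z₀ : ℝ × (EuclideanSpace ℝ (Fin 3))} (hz₀ : z₀ ∈ O) (hreg : IsRegularPoint u z₀) :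
    ∃ ρ : ℝ, 0 < ρ ∧ ∃ B : ℝ, ∀ᶠ k in atTop,
      ∀ᵐ w ∂(volume.restrict (parabolicCylinderCentered ρ z₀)), ‖useq k w.1 w.2‖ ≤ B := by
  obtain ⟨ρ₀, hρ₀, hbdd⟩ := hreg
  obtain ⟨c, hPD⟩ := hPD.ratio
  obtain ⟨ε₀, Cb, hε₀, hCb, hOS⟩ := hU
  obtain ⟨θ, hθ, hθhalf, hcθ⟩ := exists_ratio_mul_le_half c
  have hθ1 : θ ≤ 1 := hθhalf.trans (by norm_num)
  -- the essential bound of the limit near `z₀`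
  set M : ℝ≥0∞ := eLpNorm (uncurry u) ∞ (volume.restrict (parabolicCylinderCentered ρ₀ z₀)) with hMdef
  have hM : ∀ᵐ w ∂(volume.restrict (parabolicCylinderCentered ρ₀ z₀)), ‖u w.1 w.2‖ₑ ≤ M :=
    ae_enorm_le_eLpNorm_top u _
  have hMtop : M ≠ ∞ := hbdd.ne
  -- a closed box `K` around `z₀` inside `O`, of size `r₁ ≤ ρ₀/2`
  obtain ⟨r₂, hr₂, -, hKO₂⟩ := exists_closedCylinder_subset O.isOpen hz₀
  set r₁ : ℝ := min r₂ (ρ₀ / 2) with hr₁def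
  have hr₁ : 0 < r₁ := lt_min hr₂ (by positivity)
  have hr₁ρ : r₁ ≤ ρ₀ / 2 := min_le_right _ _
  set K : Set (ℝ × (EuclideanSpace ℝ (Fin 3))) := Icc (z₀.1 - r₁ ^ 2) (z₀.1 + r₁ ^ 2) ×ˢ closedBall z₀.2 r₁ with hKdef
  have hKO : K ⊆ (O : Set (ℝ × (EuclideanSpace ℝ (Fin 3)))) := by
    have : r₁ ^ 2 ≤ r₂ ^ 2 := pow_le_pow_left₀ hr₁.le (min_le_left _ _) 2
    exact Subset.trans (prod_mono (Icc_subset_Icc (by linarith) (by linarith))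
      (closedBall_subset_closedBall (min_le_left _ _))) hKO₂
  have hKc : IsCompact K := isCompact_Icc.prod (isCompact_closedBall _ _)
  -- uniform data of the situation of Prop. 2.2 on `K`
  obtain ⟨Cp, hCp⟩ := hsit.pressure_bound K hKO hKc
  have hT := hsit.tendsto_lintegral K hKO hKc
  -- cylinders `Q_r(t₀ + h, x₀)` with `0 ≤ h ≤ r₁²`, `0 < r ≤ r₁` lie in the box
  have hbox : ∀ h r, 0 ≤ h → h ≤ r₁ ^ 2 → 0 < r → r ≤ r₁ →
      closure (parabolicCylinder r (z₀.1 + h, z₀.2)) ⊆ K :=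
    fun h r h0 hh hr hrr => closure_parabolicCylinder_shift_subset_box h0 hh hr hrr z₀
  -- constants
  set V₁ : ℝ≥0∞ := volume (ball (0 : (EuclideanSpace ℝ (Fin 3))) 1) with hV₁
  have hV₁top : V₁ ≠ ∞ := measure_ball_lt_top.ne
  set Θ : ℝ≥0∞ := ENNReal.ofReal ((θ⁻¹) ^ 2) with hΘ
  set L : ℝ≥0∞ := 1 + 2 * ((c : ℝ≥0∞) * Θ) with hL
  have hLtop : L ≠ ∞ := ENNReal.add_ne_top.2 ⟨ENNReal.one_ne_top,
    ENNReal.mul_ne_top ENNReal.ofNat_ne_top (ENNReal.mul_ne_top ENNReal.coe_ne_top ENNReal.ofReal_ne_top)⟩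
  set ε : ℝ≥0∞ := ENNReal.ofReal ε₀ with hεdef
  have hε4 : 0 < ε / 4 := ENNReal.div_pos (ENNReal.ofReal_pos.2 hε₀).ne' ENNReal.ofNat_ne_top
  -- (A) the radius `r₀ ≤ r₁`: `L · 4 |B₁| M³ r₀³ ≤ ε/4`
  obtain ⟨rA, hrA, hA⟩ := exists_forall_ofReal_pow_three_mul_le (N := L * (4 * (V₁ * M ^ 3)))
    (ENNReal.mul_ne_top hLtop (ENNReal.mul_ne_top ENNReal.ofNat_ne_top
      (ENNReal.mul_ne_top hV₁top (ENNReal.pow_ne_top hMtop)))) hε4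
  set r₀ : ℝ := min r₁ rA with hr₀def
  have hr₀ : 0 < r₀ := lt_min hr₁ hrA
  have hr₀r₁ : r₀ ≤ r₁ := min_le_left _ _
  have hr₀ρ : r₀ ≤ ρ₀ := by linarith
  have hAr₀ : ENNReal.ofReal (r₀ ^ 3) * (L * (4 * (V₁ * M ^ 3))) ≤ ε / 4 := hA r₀ hr₀ (min_le_right _ _)
  -- (B) the number of steps `J`
  set P : ℝ≥0∞ := (ENNReal.ofReal r₀ ^ 2)⁻¹ * Cp with hPdef
  have hPtop : P ≠ ∞ :=
    ENNReal.mul_ne_top (ENNReal.inv_ne_top.2 (pow_ne_zero 2 (ENNReal.ofReal_pos.2 hr₀).ne')) ENNReal.coe_ne_top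
  obtain ⟨J, hJ⟩ := exists_inv_two_pow_mul_le hPtop hε4
  -- the final scale `s = θᴶ r₀`, the shift `h = s²/8`, the centre `z'`
  set s : ℝ := θ ^ J * r₀ with hsdef
  have hs : 0 < s := by positivity
  have hsr₀ : s ≤ r₀ := mul_le_of_le_one_left hr₀.le (pow_le_one₀ hθ.le hθ1)
  have hscale0 : ∀ j : ℕ, 0 < θ ^ j * r₀ := fun j => by positivity
  have hscale1 : ∀ j : ℕ, θ ^ j * r₀ ≤ r₀ := fun j =>
    mul_le_of_le_one_left hr₀.le (pow_le_one₀ hθ.le hθ1)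
  have hscale2 : ∀ j ≤ J, s ≤ θ ^ j * r₀ := fun j hj =>
    mul_le_mul_of_nonneg_right (pow_le_pow_of_le_one hθ.le hθ1 hj) hr₀.le
  set h : ℝ := s ^ 2 / 8 with hhdef
  have hh0 : 0 < h := by positivity
  have hhs : h ≤ s ^ 2 / 8 := le_rfl
  have hhs' : ∀ j ≤ J, h ≤ (θ ^ j * r₀) ^ 2 := fun j hj => by
    have : s ^ 2 ≤ (θ ^ j * r₀) ^ 2 := pow_le_pow_left₀ hs.le (hscale2 j hj) 2
    rw [hhdef]; nlinarith
  have hhr₁ : h ≤ r₁ ^ 2 := by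
    have : s ^ 2 ≤ r₁ ^ 2 := pow_le_pow_left₀ hs.le (hsr₀.trans hr₀r₁) 2
    rw [hhdef]; nlinarith
  set z' : ℝ × (EuclideanSpace ℝ (Fin 3)) := (z₀.1 + h, z₀.2) with hz'
  have hclK : ∀ r, 0 < r → r ≤ r₀ → closure (parabolicCylinder r z') ⊆ K :=
    fun r hr hrr => hbox h r hh0.le hhr₁ hr (hrr.trans hr₀r₁)
  have hclO : ∀ r, 0 < r → r ≤ r₀ → closure (parabolicCylinder r z') ⊆ (O : Set (ℝ × (EuclideanSpace ℝ (Fin 3)))) :=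
    fun r hr hrr => (hclK r hr hrr).trans hKO
  -- the regular neighbourhood `Q*_{√h}(z₀) ⊆ Q_{s/2}(z')` and the events in `k`
  have hevT : ∀ᶠ k : ℕ in atTop, L * (4 * ((ENNReal.ofReal s ^ 2)⁻¹ *
      ∫⁻ w in K, ‖useq k w.1 w.2 - u w.1 w.2‖ₑ ^ (3 : ℕ))) ≤ ε / 4 := by
    have hfin : L * (4 * (ENNReal.ofReal s ^ 2)⁻¹) ≠ ∞ :=
      ENNReal.mul_ne_top hLtop (ENNReal.mul_ne_top ENNReal.ofNat_ne_top
        (ENNReal.inv_ne_top.2 (pow_ne_zero 2 (ENNReal.ofReal_pos.2 hs).ne')))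
    have h1 := ENNReal.Tendsto.const_mul hT (Or.inr hfin)
    rw [mul_zero] at h1
    have h2 : Tendsto (fun k : ℕ => L * (4 * ((ENNReal.ofReal s ^ 2)⁻¹ *
        ∫⁻ w in K, ‖useq k w.1 w.2 - u w.1 w.2‖ₑ ^ (3 : ℕ)))) atTop (𝓝 0) := by
      refine h1.congr fun k => ?_
      simp only [mul_assoc]
    exact h2.eventually (ge_mem_nhds hε4)
  set ρ : ℝ := Real.sqrt h with hρdef
  have hρ : 0 < ρ := Real.sqrt_pos.2 hh0
  -- the regular neighbourhood `Q*_ρ(z₀) ⊆ Q_{s/2}(z')` (fixed, independent of `k`)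
  have hρ2 : ρ ^ 2 = h := Real.sq_sqrt hh0.le
  have hsub : parabolicCylinderCentered ρ z₀ ⊆ parabolicCylinder (s / 2) z' := by
    refine parabolicCylinderCentered_subset_shift ?_ hρ2.le ?_ z₀
    · have h1 : h ≤ (s / 2) ^ 2 := by rw [hhdef]; nlinarith
      calc ρ = Real.sqrt h := hρdef
        _ ≤ Real.sqrt ((s / 2) ^ 2) := Real.sqrt_le_sqrt h1
        _ = s / 2 := Real.sqrt_sq (by linarith)
    · rw [hρ2, hhdef]; nlinarith
  refine ⟨ρ, hρ, Cb / s, ?_⟩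
  filter_upwards [hevT] with k hkT
  -- the cubic inputs of the approximant `u^k`
  set T : ℝ≥0∞ := ∫⁻ w in K, ‖useq k w.1 w.2 - u w.1 w.2‖ₑ ^ (3 : ℕ) with hTdef
  set e : ℝ≥0∞ := 4 * (V₁ * M ^ 3 * ENNReal.ofReal (r₀ ^ 3)) + 4 * ((ENNReal.ofReal s ^ 2)⁻¹ * T)
    with hedef
  have hCe : ∀ j ≤ J, cknC (θ ^ j * r₀) z' (useq k) ≤ e := by
    intro j hj
    have hQS : parabolicCylinder (θ ^ j * r₀) z' ⊆ parabolicCylinderCentered ρ₀ z₀ :=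
      parabolicCylinder_shift_subset_centered_of_le hh0.le (hhs' j hj) (hscale0 j).le
        ((hscale1 j).trans hr₀ρ) z₀
    have hQK : parabolicCylinder (θ ^ j * r₀) z' ⊆ K := subset_closure.trans (hclK _ (hscale0 j) (hscale1 j))
    refine (cknC_le_of_ae_bound_of_lintegral_sub (hscale0 j) hQS hQK hM le_rfl).trans ?_
    have h1 : ENNReal.ofReal ((θ ^ j * r₀) ^ 3) ≤ ENNReal.ofReal (r₀ ^ 3) :=
      ENNReal.ofReal_le_ofReal (pow_le_pow_left₀ (hscale0 j).le (hscale1 j) 3)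
    have h2 : (ENNReal.ofReal (θ ^ j * r₀) ^ 2)⁻¹ ≤ (ENNReal.ofReal s ^ 2)⁻¹ :=
      ENNReal.inv_le_inv.2 (pow_le_pow_left' (ENNReal.ofReal_le_ofReal (hscale2 j hj)) 2)
    exact add_le_add (mul_le_mul_right (mul_le_mul_right h1 (V₁ * M ^ 3)) 4)
      (mul_le_mul_right (mul_le_mul_left h2 T) 4)
  -- the pressure of the approximant at the last scale
  have hD : cknD s z' (pseq k) ≤
      (2⁻¹ : ℝ≥0∞) ^ J * cknD r₀ z' (pseq k) + 2 * ((c : ℝ≥0∞) * Θ * e) :=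
    cknD_iterate_le_of_pressure_decay hPD hθ hθ1 hcθ (hsit.suitable k).distributional hr₀
      (subset_closure.trans (hclO r₀ hr₀ le_rfl)) (fun j hj => hCe j hj.le)
  have hD0 : cknD r₀ z' (pseq k) ≤ P :=
    (cknD_le_of_subset (pseq k) (subset_closure.trans (hclK r₀ hr₀ le_rfl))).trans
      (mul_le_mul_right (hCp k) _)
  -- smallness and the one-scale criterion for `(u^k, p^k)`
  have hsmall : cknC s z' (useq k) + cknD s z' (pseq k) ≤ ε := by
    have h1 : cknC s z' (useq k) ≤ e := hCe J le_rfl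
    have h2 : L * e ≤ ε / 4 + ε / 4 := by
      rw [hedef, mul_add]
      refine add_le_add ?_ hkT
      calc L * (4 * (V₁ * M ^ 3 * ENNReal.ofReal (r₀ ^ 3)))
          = ENNReal.ofReal (r₀ ^ 3) * (L * (4 * (V₁ * M ^ 3))) := by ring
        _ ≤ ε / 4 := hAr₀
    have h3 : (2⁻¹ : ℝ≥0∞) ^ J * cknD r₀ z' (pseq k) ≤ ε / 4 := le_trans (by gcongr) hJ
    calc cknC s z' (useq k) + cknD s z' (pseq k)
        ≤ e + ((2⁻¹ : ℝ≥0∞) ^ J * cknD r₀ z' (pseq k) + 2 * ((c : ℝ≥0∞) * Θ * e)) :=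
          add_le_add h1 hD
      _ = L * e + (2⁻¹ : ℝ≥0∞) ^ J * cknD r₀ z' (pseq k) := by rw [hL]; ring
      _ ≤ (ε / 4 + ε / 4) + ε / 4 := add_le_add h2 h3
      _ ≤ ε := ENNReal.add_quarters_le ε
  have hbk := hOS O (useq k) (pseq k) (hsit.suitable k) z' s hs (hclO s hs hsr₀) hsmall
  -- the a.e. bound on `Q_{s/2}(z') ⊇ Q*_ρ(z₀)`
  exact ae_restrict_of_ae_restrict_of_subset hsub hbk


/-- **Quantitative stability of regularity, unconditional** (all inputs are proved tree theorems:
`seregin_sverak_pressure_decay_holds`, `RRS2016.theorem15_3_holds`). -/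
theorem uniform_bound_near_regularPoint
    {O : Opens (ℝ × (EuclideanSpace ℝ (Fin 3)))}
    {useq : ℕ → ℝ → (EuclideanSpace ℝ (Fin 3)) → (EuclideanSpace ℝ (Fin 3))}
    {pseq : ℕ → ℝ → (EuclideanSpace ℝ (Fin 3)) → ℝ}
    {u : ℝ → (EuclideanSpace ℝ (Fin 3)) → (EuclideanSpace ℝ (Fin 3))} {p : ℝ → (EuclideanSpace ℝ (Fin 3)) → ℝ}
    (hsit : RusinSverak2011.CompactnessSituation O useq pseq u p)
    {z₀ : ℝ × (EuclideanSpace ℝ (Fin 3))} (hz₀ : z₀ ∈ O) (hreg : IsRegularPoint u z₀) :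
    ∃ ρ : ℝ, 0 < ρ ∧ ∃ B : ℝ, ∀ᶠ k in atTop,
      ∀ᵐ w ∂(volume.restrict (parabolicCylinderCentered ρ z₀)), ‖useq k w.1 w.2‖ ≤ B :=
  uniform_bound_near_regularPoint_of_unforced seregin_sverak_pressure_decay_holds
    (oneScale_bound_of_theorem15_3 RRS2016.theorem15_3_holds) hsit hz₀ hreg

/-- **Singular limit points from blowing-up continuous approximants** (the form used by the (J)
step): in the situation of Prop. 2.2, if the `u^k` are continuous on `O` (e.g. classical) and
`‖u^k(z_k)‖ → ∞` along points `z_k → z₀ ∈ O`, then `z₀` is NOT a regular point of the limit. -/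
theorem not_isRegularPoint_of_unbounded
    {O : Opens (ℝ × (EuclideanSpace ℝ (Fin 3)))}
    {useq : ℕ → ℝ → (EuclideanSpace ℝ (Fin 3)) → (EuclideanSpace ℝ (Fin 3))}
    {pseq : ℕ → ℝ → (EuclideanSpace ℝ (Fin 3)) → ℝ}
    {u : ℝ → (EuclideanSpace ℝ (Fin 3)) → (EuclideanSpace ℝ (Fin 3))} {p : ℝ → (EuclideanSpace ℝ (Fin 3)) → ℝ}
    (hsit : RusinSverak2011.CompactnessSituation O useq pseq u p)
    (hcont : ∀ k, ContinuousOn (uncurry (useq k)) (O : Set (ℝ × (EuclideanSpace ℝ (Fin 3)))))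
    {z : ℕ → ℝ × (EuclideanSpace ℝ (Fin 3))} {z₀ : ℝ × (EuclideanSpace ℝ (Fin 3))} (hz₀ : z₀ ∈ O)
    (hz : Tendsto z atTop (𝓝 z₀))
    (hblow : Tendsto (fun k => ‖useq k (z k).1 (z k).2‖) atTop atTop) :
    ¬ IsRegularPoint u z₀ := by
  intro hreg
  obtain ⟨ρ, hρ, B, hB⟩ := uniform_bound_near_regularPoint hsit hz₀ hreg
  -- eventually `z_k ∈ Q*_ρ(z₀)`, an open set on which `‖u^k‖ ≤ B` a.e., hence everywhere by continuity
  have hevz : ∀ᶠ k in atTop, z k ∈ parabolicCylinderCentered ρ z₀ :=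
    hz.eventually_mem ((isOpen_parabolicCylinderCentered ρ z₀).mem_nhds
      (self_mem_parabolicCylinderCentered hρ z₀))
  have hevO : ∀ᶠ k in atTop, z k ∈ (O : Set (ℝ × (EuclideanSpace ℝ (Fin 3)))) :=
    hz.eventually_mem (O.isOpen.mem_nhds hz₀)
  have hbig : ∀ᶠ k in atTop, B + 1 ≤ ‖useq k (z k).1 (z k).2‖ :=
    (hblow.eventually_ge_atTop (B + 1))
  obtain ⟨k, ⟨⟨hkB, hkz⟩, hkO⟩, hkbig⟩ := (((hB.and hevz).and hevO).and hbig).exists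
  -- continuity at `z k` inside the open set `Q*_ρ(z₀) ∩ O` contradicts the a.e. bound
  have hopen : IsOpen (parabolicCylinderCentered ρ z₀ ∩ (O : Set (ℝ × (EuclideanSpace ℝ (Fin 3))))) :=
    (isOpen_parabolicCylinderCentered ρ z₀).inter O.isOpen
  have hmem : z k ∈ parabolicCylinderCentered ρ z₀ ∩ (O : Set (ℝ × (EuclideanSpace ℝ (Fin 3)))) :=
    ⟨hkz, hkO⟩
  -- the set where `‖u^k‖ > B` is a nonempty open subset of `Q*_ρ(z₀)`, hence of positive measure
  have hcontk : ContinuousOn (fun w : ℝ × (EuclideanSpace ℝ (Fin 3)) => ‖useq k w.1 w.2‖)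
      (parabolicCylinderCentered ρ z₀ ∩ (O : Set (ℝ × (EuclideanSpace ℝ (Fin 3))))) :=
    ((hcont k).mono inter_subset_right).norm
  obtain ⟨V, hVopen, hzV, hV⟩ : ∃ V : Set (ℝ × (EuclideanSpace ℝ (Fin 3))), IsOpen V ∧ z k ∈ V ∧
      V ⊆ {w | w ∈ parabolicCylinderCentered ρ z₀ ∩ (O : Set (ℝ × (EuclideanSpace ℝ (Fin 3)))) ∧
        B < ‖useq k w.1 w.2‖} := by
    have hpre := hcontk.isOpen_inter_preimage hopen (isOpen_Ioi (a := B))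
    refine ⟨_, hpre, ⟨hmem, ?_⟩, fun w hw => ⟨hw.1, hw.2⟩⟩
    show B < ‖useq k (z k).1 (z k).2‖
    linarith
  have hVpos : 0 < volume V := hVopen.measure_pos volume ⟨z k, hzV⟩
  have hVsub : V ⊆ parabolicCylinderCentered ρ z₀ := fun w hw => (hV hw).1.1
  -- but a.e. on `Q*_ρ(z₀)`, `‖u^k‖ ≤ B`
  have hae : ∀ᵐ w ∂(volume.restrict V), ‖useq k w.1 w.2‖ ≤ B :=
    ae_restrict_of_ae_restrict_of_subset hVsub hkB
  have hae' : ∀ᵐ w ∂(volume.restrict V), False := by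
    filter_upwards [hae, ae_restrict_mem hVopen.measurableSet] with w hw hwV
    exact absurd hw (not_le.2 (hV hwV).2)
  rw [ae_iff] at hae'
  simp only [not_false_eq_true, setOf_true, Measure.restrict_apply_univ] at hae'
  exact hVpos.ne' hae'

end Summit.NavierStokesRegularity.NavierStokesRegularity.Theorems.L3TimeExponentPincerRegularPointUniformBound

end
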